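import Summits.BirchSwinnertonDyer.BirchSwinnertonDyer.Theses.QuadraticBranchSignedControl
import Summits.BirchSwinnertonDyer.Rank1Residual.Additive.SignedTwistOddBranchReadings
import HarnessLib

/-!
# Route `QuadraticBranchSignedControl` (rung K8, cell `bsd-potss`): the sign item (R2⁻)
# `NoFiniteSubmoduleMinus` (stmt-BirchSwinnertonDyer-19233) from the VERBATIM `η`-component frame of
# Kitajima–Otsuki 2018 Main Thm. 1.3 (sign `−`) — the item typed modulo ONE displayed hypothesis

HONEST FRAMING (cell `bsd-potss`, run/shared/lean/pub/bsd-potss/; FULL-BSD rank ≤ 1 programme,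
tranche 1b): CONDITIONAL RESULT — the hypothesis `hKO` is x1b's verbatim-shape frame (text `HKO p` of
cc-typer-6, intrinsic `η`-pin) of Kitajima–Otsuki 2018 Main Thm. 1.3 (= Thm. 4.8), sign `−`, read on
the `η`-COMPONENT `X⁻(V/ℚ(μ_{p^∞}))^η` of Kobayashi's §2 minus Selmer dual of the GOOD supersingular
twist `V` — the `K_n = ℚ(ζ_{p^{n+1}})`-tower object WITH the `m = −1` clause (`Tr_{n/0} P ∈ Ê(ℚ_p)`),
which IS Kitajima–Otsuki's Def. 2.1 minus condition for `F = ℚ` ("for all odd `m`, `−1 ≤ m ≤ n−1`");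
cc-typer-6's `Γ_ℚ`-internal `EtaSignedSelmerDualData V κ K₀ ℚ_[p] η γ (-1)`, `K₀ = ℚ(μ_p)`; reading
flag `KO18-eta-summand` (an `η`-part is a direct summand) — closed over `p ≥ 5` exactly as the route's
own crux frames (`EtaTransportSigned`) are. It is EXACTLY the hypothesis of x1b's landed discharge
`SignedTwist.oddBranchStrictMinusNoFiniteSubmoduleAt_of_kitajimaOtsuki13MinusEta` (file
`SignedTwistOddBranchReadings`, P5-5b), which this file merely closes over `W`, `p ≥ 5` in the ROUTE's
type. NOTHING about the printed theorem is asserted; no definition, no named Literature fact, no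
`sorry`, axioms standard; the item is NOT closed by this file. It records in the kernel that item
19233 is the `η`-frame and nothing more: the TRANSPORT of the STRICT minus dual of `W` over `ℚ_∞` to
`X⁻(V/K₀ℚ_∞)^η` (`StrictSignedSelmerDualData.toEtaSigned`, SAME module, P5-5a) is a tree THEOREM, so
the "corank drop at the ramified prime" of the item's why-it-might-fail is absorbed by the dictionary:
the strict condition on `W` IS Kobayashi's/Kitajima–Otsuki's minus condition on `V` (with its printed
`m = −1` clause), and the printed theorem speaks about exactly that group. What separates `hKO` from
print is only (a) the `η`-part being a `Λ`-direct summand of the full dual (`p ∤ #Δ`) and (b) the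
`Γ_ℚ`-internal phrasing of the `ℚ(μ_{p^∞})`-tower (no Literature-side minus object with the `m = −1`
clause exists to compare with: `KitajimaOtsuki2018/PlusSelmerNoFiniteSubmodule.lean` transcribes the
sign `+` only, for that reason).

References: [KitajimaOtsuki2018] Main Thm. 1.3 (= Thm. 4.8) with Def. 2.1 (arXiv:1607.03612 pp. 3,
6, 19); [Kobayashi2003] §2 p. 4 (the `m = −1` clause), Def. 2.1 (p. 5), §4 p. 8 (`M^η = ε_η M`).
-/

set_option autoImplicit false
set_option linter.dupNamespace false

noncomputable section

open scoped Classical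

namespace Summit.BirchSwinnertonDyer.BirchSwinnertonDyer.Theorems

open WeierstrassCurve Field Literature.NumberTheory.EllipticCurves
  Literature.NumberTheory.GaloisRepresentations ZpExtension
  Summit.BirchSwinnertonDyer.Rank1Residual.Additive
  Summit.BirchSwinnertonDyer.BirchSwinnertonDyer.Theses.QuadraticBranchSignedControl

/-- **(R2⁻) `NoFiniteSubmoduleMinus` (item stmt-BirchSwinnertonDyer-19233) from the verbatim
`η`-component frame of Kitajima–Otsuki 2018 Main Thm. 1.3, sign `−`, for every `p ≥ 5`.** The
hypothesis `hKO` reads: for `K₀ = ℚ(μ_p)`, a character `η` of `Γ_ℚ` trivial on `Gal(ℚ̄/K₀)`, a good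
`a_p = 0` curve `V/ℚ`, the cyclotomic `κ` with a topological generator `γ ∈ Gal(ℚ̄/K₀)`, and any
Pontryagin-dual datum `D` of `Sel⁻(V/K₀ℚ_∞)^η` (minus condition WITH the `m = −1` clause, as printed
in Def. 2.1) whose module is finitely generated `Λ`-torsion: `D.X` has no non-zero finite
`Λ`-submodule (flag `KO18-eta-summand`). Proof: x1b's
`oddBranchStrictMinusNoFiniteSubmoduleAt_of_kitajimaOtsuki13MinusEta` at each `W`, `p`. CONDITIONAL
on `hKO`; nothing about the printed theorem is asserted; closes nothing.
[cite: KitajimaOtsuki2018, Main Thm. 1.3 (= Thm. 4.8) with Def. 2.1 (arXiv:1607.03612 pp. 3, 6, 19)]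
[cite: Kobayashi2003, §2 p. 4, Def. 2.1 (p. 5), §4 p. 8 (the η-component)] -/
theorem noFiniteSubmoduleMinus_of_kitajimaOtsuki13MinusEta
    (hKO : ∀ (p : ℕ) [Fact p.Prime], 5 ≤ p →
      ∀ (K₀ : Type) [Field K₀] [NumberField K₀] [IsCyclotomicExtension {p} ℚ K₀]
        [(galRange (K := ℚ) K₀).Normal] (η : absoluteGaloisGroup ℚ →* ℤˣ),
        (∀ σ ∈ galRange (K := ℚ) K₀, η σ = 1) →
      ∀ (V : WeierstrassCurve ℚ) [V.IsElliptic] [V.IsGloballyMinimal],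
        p ≠ 2 → V.HasGoodReductionAtPrime p → V.frobeniusTrace p = 0 →
      ∀ (κ : ZpExtension ℚ p) (γ : absoluteGaloisGroup ℚ),
        κ.IsCyclotomic → κ.IsTopGenerator γ → γ ∈ galRange (K := ℚ) K₀ →
      ∀ (D : EtaSignedSelmerDualData V κ K₀ ℚ_[p] η γ (-1)),
        Module.Finite (IwasawaAlgebra p) D.X → Module.IsTorsion (IwasawaAlgebra p) D.X →
        ∀ M : Submodule (IwasawaAlgebra p) D.X, Finite M → M = ⊥) :
    NoFiniteSubmoduleMinus :=
  fun W _ _ p _ hp5 =>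
    SignedTwist.oddBranchStrictMinusNoFiniteSubmoduleAt_of_kitajimaOtsuki13MinusEta W p (hKO p hp5)

end Summit.BirchSwinnertonDyer.BirchSwinnertonDyer.Theorems

end
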